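import Mathlib
import Summits.NavierStokesRegularity.NavierStokesRegularity.Theorems.EulerZoomLiouvillePowerGaugeEulerLiouvilleSelfSimilarCommutingVorticity
import HarnessLib

/-!
# Crux `EulerZoomLiouville.PowerGaugeEulerLiouville` (stmt-NavierStokesRegularity-19832), THE ONE STATEMENT `stub_selfSimilarC2Needle`:
# THE FAR-FIELD VORTICITY OF A `C²` COLLAPSE PROFILE IS THE SCATTERING DATA OF THE COMMUTATOR `[V, curl V]`

Helper file (theorems only; `--supports stmt-NavierStokesRegularity-19832`; def-free).  Hand leafhand-ns-eulerzoomliouville-10 g1, sequel of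
`…SelfSimilarCommutingVorticity` (ray representation `curl U(y) = −γ⁻¹∫₀¹ s^{1/γ−1}[U, curl U](sy) ds`).

For a `C²` self-similar Euler profile `(U, P)` (CIV (3.3), centre `0`, `0 < γ ≤ 1` — every class rate `γ = 1/(2+ρ)` qualifies), `Ω = curl U`,
`[U, Ω] = convect U Ω − convect Ω U`:

* `FarFieldSource.rpow_smul_curl_eq_integral` — SCALED RAY REPRESENTATION: for every direction `θ` and radius `R ≥ 0`,
  `R^{1/γ} Ω(Rθ) = −γ⁻¹ ∫₀ᴿ r^{1/γ−1} [U, Ω](rθ) dr`.  So `R ↦ R^{1/γ} Ω(Rθ)` is (minus `γ⁻¹` times) the primitive of the weighted commutator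
  along the ray: the vorticity at radius `R` is manufactured by the commutator INSIDE the ball of radius `R`, with weight `r^{1/γ−1} = r^{1+ρ}`.
* `FarFieldSource.norm_curl_le_of_commutator_le` — POINTWISE DOMINATION: `‖Ω(y)‖ ≤ sup_{s∈[0,1]} ‖[U, Ω](sy)‖` (exact constant `1`:
  `γ⁻¹∫₀¹ s^{1/γ−1} ds = 1`).
* `FarFieldSource.tendsto_rpow_smul_curl` — SCATTERING LIMIT: if the weighted commutator `r ↦ r^{1/γ−1}[U, Ω](rθ)` is integrable on `(0, ∞)`
  (true for the window tails `|U| ~ r^{−(1+ρ)}`, `|DΩ| ~ r^{−(3+ρ)}`: weight × commutator `~ r^{−3−ρ}`), then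
  `R^{1/γ} Ω(Rθ) → Θ(θ) := −γ⁻¹ ∫₀^∞ r^{1/γ−1}[U, Ω](rθ) dr` as `R → ∞`: the vorticity is ASYMPTOTICALLY HOMOGENEOUS of the critical degree
  `−1/γ = −(2+ρ)` along every ray, with angular profile equal to the total weighted commutator budget of the ray.
* `FarFieldSource.tendsto_zero_iff_integral_eq_zero` — hence the vorticity decays FASTER than the critical rate along the ray `θ`
  iff the ray's commutator budget balances, `∫₀^∞ r^{1/γ−1}[U, Ω](rθ) dr = 0`; e.g. every profile with compactly supported (or
  sub-critically decaying) vorticity has balanced budgets on all rays, and an unbalanced ray forces a vorticity tail of EXACTLY the critical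
  order `|y|^{−(2+ρ)}` there (the order of the extremal window tails).

WHAT THIS IS NOT: not a proof of the stub, the crux, or the route; nothing about Navier–Stokes. [folklore; ConstantinIgnatovaVicol2026Putative
§3.1.1 (3.4); Kambe2004 §8.8.1 (the commutator `[u, ω]`)]
-/

noncomputable section

-- flat `Theorems/<Route><Decl>…` files of one crux share the namespace of the crux (tree convention)
set_option linter.dupNamespace false

open MeasureTheory Set Filter Topology Metric Function intervalIntegral
open scoped RealInnerProductSpace NNReal ENNReal ContDiff

namespace Summit.NavierStokesRegularity.NavierStokesRegularity.Theorems.PowerGaugeEulerLiouville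

open Literature.Analysis Literature.Analysis.FluidPDE

namespace FarFieldSource

variable {γ : ℝ} {U : EuclideanSpace ℝ (Fin 3) → EuclideanSpace ℝ (Fin 3)} {P : EuclideanSpace ℝ (Fin 3) → ℝ}

/-- The commutator `[U, curl U]` of a `C²` self-similar Euler profile is continuous. [folklore] -/
theorem continuous_commutator (hprof : IsSelfSimilarEulerProfile γ 0 U P) :
    Continuous fun z => convect U (curl U) z - convect (curl U) U z := by
  have hU2 : ContDiff ℝ 2 U := hprof.contDiff_velocity
  have hΩd : Differentiable ℝ (curl U) := differentiable_curl_of_contDiff hU2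
  have hΩ1 : ContDiff ℝ 1 (curl U) := contDiff_curl_of_succ (n := 1) (by exact_mod_cast hU2)
  have h1 : Continuous fun z => fderiv ℝ (curl U) z (U z) :=
    (hΩ1.continuous_fderiv one_ne_zero).clm_apply hU2.continuous
  have h2 : Continuous fun z => fderiv ℝ U z (curl U z) :=
    (hU2.continuous_fderiv (by norm_num)).clm_apply hΩd.continuous
  simpa [convect_apply, Pi.sub_def] using h1.sub h2

/-- **SCALED RAY REPRESENTATION** (`0 < γ ≤ 1`): for every `θ` and `R ≥ 0`,
`R^{1/γ} • curl U (R • θ) = −γ⁻¹ ∫₀ᴿ r^{1/γ−1} • [U, curl U](r • θ) dr` — the fundamental theorem of calculus for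
`g(r) = r^{1/γ} Ω(rθ)`, whose derivative is `−γ⁻¹ r^{1/γ−1}[U, Ω](rθ)` by CIV (3.4) (`RaySource.smul_fderiv_curl_self_eq`). [folklore] -/
theorem rpow_smul_curl_eq_integral (hprof : IsSelfSimilarEulerProfile γ 0 U P) (hγ : 0 < γ) (hγ1 : γ ≤ 1)
    (θ : EuclideanSpace ℝ (Fin 3)) {R : ℝ} (hR : 0 ≤ R) :
    (R ^ (1 / γ)) • curl U (R • θ) = -(γ⁻¹ • ∫ r in (0:ℝ)..R,
      (r ^ (1 / γ - 1)) • (convect U (curl U) (r • θ) - convect (curl U) U (r • θ))) := by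
  have hγ0 : γ ≠ 0 := hγ.ne'
  have hU2 : ContDiff ℝ 2 U := hprof.contDiff_velocity
  have hΩd : Differentiable ℝ (curl U) := differentiable_curl_of_contDiff hU2
  set C : EuclideanSpace ℝ (Fin 3) → EuclideanSpace ℝ (Fin 3) :=
    fun z => convect U (curl U) z - convect (curl U) U z with hC
  have hCc : Continuous C := continuous_commutator hprof
  set p : ℝ := 1 / γ with hp
  have hp1 : 1 ≤ p := by rw [hp, le_div_iff₀ hγ, one_mul]; exact hγ1
  have hp0 : 0 < p := lt_of_lt_of_le one_pos hp1
  have hpγ : p = γ⁻¹ := one_div γ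
  set g : ℝ → EuclideanSpace ℝ (Fin 3) := fun r => (r ^ p) • curl U (r • θ) with hg
  set g' : ℝ → EuclideanSpace ℝ (Fin 3) := fun r => -(γ⁻¹ • ((r ^ (p - 1)) • C (r • θ))) with hg'
  have hcont : ContinuousOn g (Icc 0 R) :=
    ((Real.continuous_rpow_const hp0.le).smul
      (hΩd.continuous.comp (continuous_id.smul continuous_const))).continuousOn
  have hg'c : Continuous g' :=
    (((Real.continuous_rpow_const (by linarith)).smul
      (hCc.comp (continuous_id.smul continuous_const))).const_smul γ⁻¹).neg
  have hint : IntervalIntegrable g' volume 0 R := hg'c.intervalIntegrable 0 R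
  have hderiv : ∀ r ∈ Ioo (0:ℝ) R, HasDerivAt g (g' r) r := by
    intro r hr
    have hr0 : 0 < r := hr.1
    have h1 : HasDerivAt (fun r : ℝ => r ^ p) (p * r ^ (p - 1)) r := Real.hasDerivAt_rpow_const (Or.inl hr0.ne')
    have hline : HasDerivAt (fun r : ℝ => r • θ) ((1:ℝ) • θ) r := (hasDerivAt_id' r).smul_const θ
    have h2' := (hΩd (r • θ)).hasFDerivAt.comp_hasDerivAt r hline
    rw [one_smul] at h2'
    have h2 : HasDerivAt (fun r : ℝ => curl U (r • θ)) (fderiv ℝ (curl U) (r • θ) θ) r := h2'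
    have h12 := h1.smul h2
    have hrθ : r • fderiv ℝ (curl U) (r • θ) θ = γ⁻¹ • (-(curl U (r • θ)) - C (r • θ)) := by
      have hk := RaySource.smul_fderiv_curl_self_eq hprof (r • θ)
      rw [map_smul] at hk
      calc r • fderiv ℝ (curl U) (r • θ) θ = γ⁻¹ • (γ • r • fderiv ℝ (curl U) (r • θ) θ) := by
            rw [smul_smul γ⁻¹ γ, inv_mul_cancel₀ hγ0, one_smul]
        _ = γ⁻¹ • (-(curl U (r • θ)) - C (r • θ)) := by rw [hk]
    have hpow : r ^ p = r ^ (p - 1) * r := by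
      rw [Real.rpow_sub_one hr0.ne', div_mul_cancel₀ _ hr0.ne']
    have hval : r ^ p • fderiv ℝ (curl U) (r • θ) θ + (p * r ^ (p - 1)) • curl U (r • θ) = g' r := by
      rw [hg', hpow, mul_smul, hrθ, hpγ]
      module
    exact h12.congr_deriv hval
  have hftc := integral_eq_sub_of_hasDerivAt_of_le hR hcont hderiv hint
  have hg0 : g 0 = 0 := by simp [hg, Real.zero_rpow hp0.ne']
  rw [hg0, sub_zero] at hftc
  -- `hftc : ∫ g' = g R`
  show (R ^ p) • curl U (R • θ) = _
  rw [show (R ^ p) • curl U (R • θ) = g R from rfl, ← hftc, hg']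
  simp only [intervalIntegral.integral_neg, intervalIntegral.integral_smul, hp, hC]

/-- **POINTWISE DOMINATION OF THE VORTICITY BY THE COMMUTATOR ON THE SEGMENT `[0, y]`** (`0 < γ ≤ 1`, sharp constant `1`):
if `‖[U, curl U](s y)‖ ≤ M` for all `s ∈ [0,1]`, then `‖curl U (y)‖ ≤ M` (`γ⁻¹ ∫₀¹ s^{1/γ−1} M ds = M`). [folklore] -/
theorem norm_curl_le_of_commutator_le (hprof : IsSelfSimilarEulerProfile γ 0 U P) (hγ : 0 < γ) (hγ1 : γ ≤ 1)
    {y : EuclideanSpace ℝ (Fin 3)} {M : ℝ}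
    (hM : ∀ s ∈ Icc (0:ℝ) 1, ‖convect U (curl U) (s • y) - convect (curl U) U (s • y)‖ ≤ M) :
    ‖curl U y‖ ≤ M := by
  have hγ0 : γ ≠ 0 := hγ.ne'
  set p : ℝ := 1 / γ with hp
  have hp1 : 1 ≤ p := by rw [hp, le_div_iff₀ hγ, one_mul]; exact hγ1
  have hp0 : 0 < p := lt_of_lt_of_le one_pos hp1
  have hM0 : 0 ≤ M := le_trans (norm_nonneg _) (hM 0 ⟨le_rfl, zero_le_one⟩)
  rw [RaySource.curl_eq_integral_commutator hprof hγ hγ1 y, norm_neg, norm_smul, Real.norm_eq_abs,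
    abs_of_pos (inv_pos.2 hγ)]
  -- `‖∫₀¹ s^{p−1} • C(sy)‖ ≤ ∫₀¹ s^{p−1} M = M / p`
  have hbound : ‖∫ s in (0:ℝ)..1, (s ^ (1 / γ - 1)) • (convect U (curl U) (s • y) - convect (curl U) U (s • y))‖ ≤
      ∫ s in (0:ℝ)..1, s ^ (p - 1) * M := by
    refine intervalIntegral.norm_integral_le_of_norm_le zero_le_one ?_ ?_
    · refine Filter.Eventually.of_forall fun s hs => ?_
      have hs' : s ∈ Icc (0:ℝ) 1 := ⟨hs.1.le, hs.2⟩
      rw [norm_smul, Real.norm_eq_abs, abs_of_nonneg (Real.rpow_nonneg hs.1.le _), ← hp]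
      exact mul_le_mul_of_nonneg_left (hM s hs') (Real.rpow_nonneg hs.1.le _)
    · exact ((Real.continuous_rpow_const (by linarith)).mul continuous_const).intervalIntegrable 0 1
  have hval : ∫ s in (0:ℝ)..1, s ^ (p - 1) * M = M / p := by
    rw [intervalIntegral.integral_mul_const, integral_rpow (Or.inl (by linarith))]
    simp [sub_add_cancel, Real.zero_rpow hp0.ne']
    ring
  rw [hval] at hbound
  calc γ⁻¹ * ‖∫ s in (0:ℝ)..1, (s ^ (1 / γ - 1)) • (convect U (curl U) (s • y) - convect (curl U) U (s • y))‖
      ≤ γ⁻¹ * (M / p) := mul_le_mul_of_nonneg_left hbound (inv_pos.2 hγ).le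
    _ = M := by rw [hp]; field_simp

/-- **SCATTERING LIMIT: the far-field vorticity is asymptotically homogeneous of the critical degree `−1/γ`, with angular profile the
total weighted commutator of the ray** (`0 < γ ≤ 1`): if `r ↦ r^{1/γ−1} • [U, curl U](r • θ)` is integrable on `(0, ∞)`, then
`R^{1/γ} • curl U (R • θ) → −γ⁻¹ • ∫₀^∞ r^{1/γ−1} • [U, curl U](r • θ) dr` as `R → ∞`. [folklore] -/
theorem tendsto_rpow_smul_curl (hprof : IsSelfSimilarEulerProfile γ 0 U P) (hγ : 0 < γ) (hγ1 : γ ≤ 1)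
    (θ : EuclideanSpace ℝ (Fin 3))
    (hint : IntegrableOn (fun r : ℝ => (r ^ (1 / γ - 1)) • (convect U (curl U) (r • θ) - convect (curl U) U (r • θ)))
      (Ioi 0)) :
    Tendsto (fun R : ℝ => (R ^ (1 / γ)) • curl U (R • θ)) atTop
      (𝓝 (-(γ⁻¹ • ∫ r in Ioi (0:ℝ), (r ^ (1 / γ - 1)) • (convect U (curl U) (r • θ) - convect (curl U) U (r • θ))))) := by
  have hlim := (MeasureTheory.intervalIntegral_tendsto_integral_Ioi 0 hint tendsto_id).const_smul γ⁻¹ |>.neg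
  refine hlim.congr' ?_
  filter_upwards [eventually_ge_atTop (0:ℝ)] with R hR
  simp only [id]
  exact (rpow_smul_curl_eq_integral hprof hγ hγ1 θ hR).symm

/-- **The vorticity decays faster than the critical rate along a ray iff the ray's weighted commutator budget balances** (`0 < γ ≤ 1`,
integrable weighted commutator): `R^{1/γ} curl U (Rθ) → 0` iff `∫₀^∞ r^{1/γ−1}[U, curl U](rθ) dr = 0`. [folklore] -/
theorem tendsto_zero_iff_integral_eq_zero (hprof : IsSelfSimilarEulerProfile γ 0 U P) (hγ : 0 < γ) (hγ1 : γ ≤ 1)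
    (θ : EuclideanSpace ℝ (Fin 3))
    (hint : IntegrableOn (fun r : ℝ => (r ^ (1 / γ - 1)) • (convect U (curl U) (r • θ) - convect (curl U) U (r • θ)))
      (Ioi 0)) :
    Tendsto (fun R : ℝ => (R ^ (1 / γ)) • curl U (R • θ)) atTop (𝓝 0) ↔
      ∫ r in Ioi (0:ℝ), (r ^ (1 / γ - 1)) • (convect U (curl U) (r • θ) - convect (curl U) U (r • θ)) = 0 := by
  have hlim := tendsto_rpow_smul_curl hprof hγ hγ1 θ hint
  constructor
  · intro h0
    have heq := tendsto_nhds_unique hlim h0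
    rw [neg_eq_zero, smul_eq_zero] at heq
    rcases heq with h | h
    · exact absurd h (inv_ne_zero hγ.ne')
    · exact h
  · intro h0
    rw [h0, smul_zero, neg_zero] at hlim
    exact hlim

end FarFieldSource

end Summit.NavierStokesRegularity.NavierStokesRegularity.Theorems.PowerGaugeEulerLiouville

end
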